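import Summits.CriticalPhenomena.PercolationContinuityZ3.Theorems.Transplant.FKConnectivityAllQK5CellsDefs
import HarnessLib

/-!
# Connectivity correlation inequalities for `φ_{w,q}`, every `q > 0` — the `K₅` KERNEL CERTIFICATE, file 3a (`decide`, part 1 of 8):
# the Bernstein test `K5.CellOK I J` on the fibers `I ⊆ J` with `maskOf J ∈ [0, 111)`

Helper file (`--supports stmt-CriticalPhenomena-4575`), FK sub-lane `prim-bschramm-fk-3` (gen 10) of the post-continuity programme;
builds on p205010 (kernel theorem, internal audit signed; external expert review pending).  No definitions, no named facts, no sorries;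
standard axioms.  Pure kernel computation (`decide +kernel`) on the data of `…K5CellsDefs`: for each mask `m` in the stated range and
each `I ⊆ ofMask m`, all twelve scaled Bernstein coefficients of the fiber polynomial of `(conf I, conf (ofMask m))` are `≥ 0`.  The
24 shards are balanced by the number `3^{|J|}` of table look-ups (`≤ 3000` each except the full mask `255` with `3^8 = 6561`; a few
tens of seconds of kernel time per shard, default heartbeats); the eight files together cover all `256` masks, i.e. all `6561` fibers of
`K₅ − {01, 02}` (assembled in `…K5`: `K5.cellOK_all`).  The same numbers were certified outside Lean by fk-3 gen 9
(bschramm/prim-bschramm-fk-3/DOUBLE-WHEELS.md §10, K5-KERNEL-PLAN.md §7a).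
[cite: Wagner2006, Conj. 5.3, Ex. 5.1–5.2 (p. 13)] [cite: Grimmett2006, §3.9 eq. (3.94) (pp. 63–64)]
-/

namespace Summit.CriticalPhenomena.PercolationContinuityZ3.Theorems

namespace FK

namespace K5

/-- **Shard 0**: `CellOK I (ofMask m)` for `0 ≤ m < 61` and all `I ⊆ ofMask m` (`2881` table look-ups). [folklore] -/
theorem cellOK_shard0 : ∀ m ∈ Finset.Ico 0 61, ∀ I ∈ (ofMask m).powerset, CellOK I (ofMask m) := by
  decide +kernel

/-- **Shard 1**: `CellOK I (ofMask m)` for `61 ≤ m < 92` and all `I ⊆ ofMask m` (`2991` table look-ups). [folklore] -/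
theorem cellOK_shard1 : ∀ m ∈ Finset.Ico 61 92, ∀ I ∈ (ofMask m).powerset, CellOK I (ofMask m) := by
  decide +kernel

/-- **Shard 2**: `CellOK I (ofMask m)` for `92 ≤ m < 111` and all `I ⊆ ofMask m` (`2871` table look-ups). [folklore] -/
theorem cellOK_shard2 : ∀ m ∈ Finset.Ico 92 111, ∀ I ∈ (ofMask m).powerset, CellOK I (ofMask m) := by
  decide +kernel

end K5

end FK

end Summit.CriticalPhenomena.PercolationContinuityZ3.Theorems
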